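import Summits.NavierStokesRegularity.NavierStokesRegularity.Theorems.ScenarioCensusRowF1ax
import Literature.Analysis.FluidPDE.BarkerPrange2020VorticityAlignmentTypeIHolds
import Summits.NavierStokesRegularity.NavierStokesRegularity.Theorems.SymmetryModuliCountAxisymEndLiouville
import Summits.NavierStokesRegularity.NavierStokesRegularity.Theorems.SymmetryModuliCountHelicalEndLiouville
import Literature.Analysis.FluidPDE.SwirlTransportProofs
import HarnessLib
import Summits.NavierStokesRegularity.NavierStokesRegularity.Theorems.ScenarioCensusRowF1ColumnarTop

/-!
# Census row F1, the KILLING DEFECT (cells F1sy / F1ks / F1kt; floor RMB «rigid motions break on the top») — LINE 33 «symmetric-top» port, part 1/3: §1 Killing generators, the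
# KILLING DEFECT, its parabolic size; hypotheses, the rows `Row_F1sy` / `Row_F1ks` / `Row_F1kt`, the floor `RigidMotionsBreak`, the residual `SymmetricCollapse` (≡ `Row_F1`), the
# split; §2 the singular Type-I zoom package with gradients (LINE 15 VERBATIM — BY NAME `ColumnarTop.exists_singularZoom_package`); §3 THE KILL

Re-homed for the scenario census (typer seat ns-census-typer-1 g9; the cells F1sy / F1ks / F1kt and the floor are MEMBERS OF RECORD «DECIDED IN KERNEL IN FILES» of row F1
since census v1.97 (item 67: critic idea-crit-3 PASS; ref PRE-CHECK ✓; lead-presearch label); this port makes them TREE-decided): VERBATIM PORT of ns-idea-3 LINE 33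
«symmetric-top», `pub/ideators/ns-idea-3/lines/symmetric-top/line-symmetric-top.lean` sha16 b59608429eb1d133 (901 l., lean check rc 0, 0 sorry), split for the 400-line
rule into `ScenarioCensusRowF1SymmetricTop` (§1–§3) → `…SymmetricTopTransfer` (§4) → `…SymmetricTopRows` (§5–§6 + census KEYS).  Lean text VERBATIM in namespace
`…Theorems.ScenarioCensus.SymmetricTop` (the line's `…Cruxes.ScenarioCensusRowF1.SymmetricTopLine` re-homed); port edits: §2's zoom package / `tendsto_physicalTime` / `isOpen_ne_zero` are the landed columnar-top port's, taken BY
NAME (`ColumnarTop.…`); §6 keeps the line's VERBATIM restatement of LINE 15's `HasColumnarTop` / `Row_F1co` for the order lemma (the census key `Row_F1co` is the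
columnar-top port's); `@[conjecture]` on the residual `SymmetricCollapse` (≡ `ScenarioCensus.Row_F1`, OPEN); three one-line
docstrings added (gate lint).  Statements untouched.

No census VALUE is moved here (row F1 stays OPEN-WITH-LINE; the members become TREE-decided by name); NS regularity is NOT proved; `Row_F1` is untouched (zero
movement, `symmetricCollapse_iff_rowF1`); no summit statement is proved by this file. Lemmas that restate already-landed tree declarations are taken BY NAME (gate lint `dedup.landed`): `exists_singularZoom_package` = `ColumnarTop.exists_singularZoom_package`, `tendsto_physicalTime` = `ColumnarTop.tendsto_physicalTime`, `isOpen_ne_zero` = `ColumnarTop.isOpen_ne_zero`.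
-/

-- the summit and its single problem share the name `NavierStokesRegularity` (D-0017 nested layout)
set_option linter.dupNamespace false

noncomputable section

open MeasureTheory Set Function Filter TopologicalSpace Metric
open scoped Topology NNReal ENNReal InnerProductSpace RealInnerProductSpace

namespace Summit.NavierStokesRegularity.NavierStokesRegularity.Theorems.ScenarioCensus.SymmetricTop

open Literature.Analysis Literature.Analysis.FluidPDE
open Summit.NavierStokesRegularity.NavierStokesRegularity.Theorems
open Summit.NavierStokesRegularity.NavierStokesRegularity.Theses

/-- `ℝ³`. -/
abbrev E3 := EuclideanSpace ℝ (Fin 3)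

/-! ## §1 Killing generators, the KILLING DEFECT, its parabolic size; hypotheses, rows, floor, residual, split -/

/-- **Skew generator** (infinitesimal rotation): `⟪A x, x⟫ = 0` for all `x` (the tree's rendering, cf.
`SymmetryModuliCount.AxisymEndLiouville`). -/
def IsSkew (A : E3 →L[ℝ] E3) : Prop := ∀ x : E3, ⟪A x, x⟫_ℝ = 0

/-- **Killing defect** of a vector field `v` along the Killing field `K(x) = a + A x` of `ℝ³` (`A` skew): the Lie
derivative `L_K v = (K·∇)v − A v`.  `v` is invariant under the one-parameter group of rigid motions generated by
`K` iff `L_K v ≡ 0` (translations `A = 0`; rotations about the axis `c + ker A` when `a = −A c`; screw motions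
otherwise). -/
def killingDefect (a : E3) (A : E3 →L[ℝ] E3) (v : E3 → E3) (x : E3) : E3 :=
  fderiv ℝ v x (a + A x) - A (v x)

/-- **Parabolic size of the generator** at `(t, x)`: `|K(x)| + √(ν(T − t)) ‖A‖` — the size of `K` on the parabolic
ball `B(x, √(ν(T−t)))` (up to a factor 2).  Dividing the defect by it makes the hypotheses invariant under
`K ↦ λK`, under rigid motions and under the Navier–Stokes scaling. -/
def killingSize (ν T : ℝ) (a : E3) (A : E3 →L[ℝ] E3) (t : ℝ) (x : E3) : ℝ :=
  ‖a + A x‖ + Real.sqrt (ν * (T - t)) * ‖A‖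

/-- **Exact rigid symmetry of the late slices**: eventually as `t ↑ T`, `L_K u(t, ·) ≡ 0` on `ℝ³`. -/
def HasRigidSymmetry (T : ℝ) (a : E3) (A : E3 →L[ℝ] E3) (u : ℝ → E3 → E3) : Prop :=
  ∀ᶠ t in 𝓝[<] T, ∀ x : E3, killingDefect a A (u t) x = 0

/-- **Killing slack (global o-form)**: for every `ε > 0`, eventually as `t ↑ T`, at EVERY point
`(T − t) |L_K u(t, x)| ≤ ε (|K(x)| + √(ν(T−t)) ‖A‖)`. -/
def HasKillingSlack (ν T : ℝ) (a : E3) (A : E3 →L[ℝ] E3) (u : ℝ → E3 → E3) : Prop :=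
  ∀ ε : ℝ, 0 < ε → ∀ᶠ t in 𝓝[<] T, ∀ x : E3,
    (T - t) * ‖killingDefect a A (u t) x‖ ≤ ε * killingSize ν T a A t x

/-- **Killing slack on the top (every Type-I-scale level)**: for every level `Λ > 0` and every `ε > 0`,
eventually as `t ↑ T`, the dimensionless defect is `≤ ε` at every point of the TOP
`{x : √(T − t) |u(t, x)| ≥ Λ √ν}`.  Nothing is asked off the top. -/
def HasKillingSlackTop (ν T : ℝ) (a : E3) (A : E3 →L[ℝ] E3) (u : ℝ → E3 → E3) : Prop :=
  ∀ Λ : ℝ, 0 < Λ → ∀ ε : ℝ, 0 < ε → ∀ᶠ t in 𝓝[<] T, ∀ x : E3,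
    Λ * Real.sqrt ν ≤ Real.sqrt (T - t) * ‖u t x‖ →
    (T - t) * ‖killingDefect a A (u t) x‖ ≤ ε * killingSize ν T a A t x

/-- **Symmetric end**: some NONZERO Killing generator `(a, A)` (`A` skew) is an exact symmetry of the late slices
(axisymmetric WITH swirl about any axis; helical of any pitch about any axis; invariant along a line). -/
def HasSymmetricEnd (T : ℝ) (u : ℝ → E3 → E3) : Prop :=
  ∃ (a : E3) (A : E3 →L[ℝ] E3), IsSkew A ∧ ¬ (a = 0 ∧ A = 0) ∧ HasRigidSymmetry T a A u

/-- **Almost symmetric end** (global o-form) for some nonzero Killing generator. -/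
def HasAlmostSymmetricEnd (ν T : ℝ) (u : ℝ → E3 → E3) : Prop :=
  ∃ (a : E3) (A : E3 →L[ℝ] E3), IsSkew A ∧ ¬ (a = 0 ∧ A = 0) ∧ HasKillingSlack ν T a A u

/-- **Almost symmetric top** for some nonzero Killing generator. -/
def HasAlmostSymmetricTop (ν T : ℝ) (u : ℝ → E3 → E3) : Prop :=
  ∃ (a : E3) (A : E3 →L[ℝ] E3), IsSkew A ∧ ¬ (a = 0 ∧ A = 0) ∧ HasKillingSlackTop ν T a A u

/-- The Killing size is non-negative. -/
theorem killingSize_nonneg (ν T : ℝ) (a : E3) (A : E3 →L[ℝ] E3) (t : ℝ) (x : E3) :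
    0 ≤ killingSize ν T a A t x := by
  unfold killingSize; positivity

/-- Exact symmetry ⇒ global slack. -/
theorem HasRigidSymmetry.hasKillingSlack {ν T : ℝ} {a : E3} {A : E3 →L[ℝ] E3} {u : ℝ → E3 → E3}
    (h : HasRigidSymmetry T a A u) : HasKillingSlack ν T a A u := by
  intro ε hε
  filter_upwards [h] with t ht x
  rw [ht x, norm_zero, mul_zero]
  exact mul_nonneg hε.le (killingSize_nonneg ν T a A t x)

/-- Global slack ⇒ slack on the top. -/
theorem HasKillingSlack.hasKillingSlackTop {ν T : ℝ} {a : E3} {A : E3 →L[ℝ] E3} {u : ℝ → E3 → E3}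
    (h : HasKillingSlack ν T a A u) : HasKillingSlackTop ν T a A u :=
  fun _ _ ε hε => (h ε hε).mono fun _ ht x _ => ht x

/-- A symmetric end is an almost symmetric end. -/
theorem HasSymmetricEnd.hasAlmostSymmetricEnd {ν T : ℝ} {u : ℝ → E3 → E3} (h : HasSymmetricEnd T u) :
    HasAlmostSymmetricEnd ν T u := by
  obtain ⟨a, A, hA, hne, h⟩ := h
  exact ⟨a, A, hA, hne, h.hasKillingSlack⟩

/-- An almost symmetric end is an almost symmetric top. -/
theorem HasAlmostSymmetricEnd.hasAlmostSymmetricTop {ν T : ℝ} {u : ℝ → E3 → E3}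
    (h : HasAlmostSymmetricEnd ν T u) : HasAlmostSymmetricTop ν T u := by
  obtain ⟨a, A, hA, hne, h⟩ := h
  exact ⟨a, A, hA, hne, h.hasKillingSlackTop⟩

/-- The rest state has every rigid symmetry (consistency witness: the hypotheses are satisfiable fields). -/
theorem hasRigidSymmetry_zero (T : ℝ) (a : E3) (A : E3 →L[ℝ] E3) :
    HasRigidSymmetry T a A (fun _ _ => 0) :=
  Eventually.of_forall fun t x => by simp [killingDefect]

/-- **Criterion row F1sy** (Type I · SYMMETRIC END — some nonzero Killing generator annihilates the late slices —
· Clay ⇒ extension): the frame of `ScenarioCensus.Row_F1` verbatim plus `HasSymmetricEnd T u`.  PROVED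
(`rowF1sy_holds`).  The `ε = 0` anchor: axisymmetric-with-swirl Type-I blow-up about ANY axis (Seregin–Šverák
2009 / KNSS 2009 Thm 6.2 in print for the vertical axis, tree `ScenarioCensus.row_F2_excluded`), helical, columnar. -/
def Row_F1sy : Prop :=
  ∀ (ν T : ℝ), 0 < ν → 0 < T →
    ∀ (u : ℝ → E3 → E3) (p : ℝ → E3 → ℝ),
    IsClassicalNSSolutionOn (Ico 0 T) ν 0 u p → IsLerayHopfOn T ν 0 (u 0) u →
    HasRapidSpatialDecay (u 0) → IsTypeIBlowup u T → HasSymmetricEnd T u →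
    HasSmoothExtensionPast ν 0 u T

/-- **Criterion row F1ks** (Type I · ALMOST SYMMETRIC END, global o-form: `(T−t)|L_K u| = o(|K| + √(ν(T−t))‖A‖)`
uniformly on `ℝ³` for one nonzero Killing `K` · Clay ⇒ extension).  PROVED (`rowF1ks_holds`).  NEW. -/
def Row_F1ks : Prop :=
  ∀ (ν T : ℝ), 0 < ν → 0 < T →
    ∀ (u : ℝ → E3 → E3) (p : ℝ → E3 → ℝ),
    IsClassicalNSSolutionOn (Ico 0 T) ν 0 u p → IsLerayHopfOn T ν 0 (u 0) u →
    HasRapidSpatialDecay (u 0) → IsTypeIBlowup u T → HasAlmostSymmetricEnd ν T u →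
    HasSmoothExtensionPast ν 0 u T

/-- **Criterion row F1kt** (Type I · ALMOST SYMMETRIC TOP: the dimensionless Killing defect of one nonzero Killing
`K` tends to `0` on the top `{√(T−t)|u| ≥ Λ√ν}` of EVERY level `Λ > 0` · Clay ⇒ extension).  PROVED
(`rowF1kt_holds`); the strongest row of the line (`Row_F1kt → Row_F1ks → Row_F1sy`).  NEW. -/
def Row_F1kt : Prop :=
  ∀ (ν T : ℝ), 0 < ν → 0 < T →
    ∀ (u : ℝ → E3 → E3) (p : ℝ → E3 → ℝ),
    IsClassicalNSSolutionOn (Ico 0 T) ν 0 u p → IsLerayHopfOn T ν 0 (u 0) u →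
    HasRapidSpatialDecay (u 0) → IsTypeIBlowup u T → HasAlmostSymmetricTop ν T u →
    HasSmoothExtensionPast ν 0 u T

/-- **RIGID MOTIONS BREAK ON THE TOP** (structural floor, maximal frame): at a maximal Type-I Clay blow-up, for
EVERY nonzero Killing generator the top is NOT almost symmetric — some level `Λ` and some `ε > 0` see, at times
arbitrarily close to `T`, a `Λ`-fast point where `(T − t)|L_K u| > ε (|K| + √(ν(T−t))‖A‖)`.  PROVED
(`rigidMotionsBreak_holds`, display `rigidMotionsBreak_unfolded`). -/
def RigidMotionsBreak : Prop :=
  ∀ (ν T : ℝ), 0 < ν → 0 < T →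
    ∀ (u : ℝ → E3 → E3) (p : ℝ → E3 → ℝ),
    IsMaximalSmoothSolution ν 0 u p T → IsLerayHopfOn T ν 0 (u 0) u →
    HasRapidSpatialDecay (u 0) → IsTypeIBlowup u T →
    ∀ (a : E3) (A : E3 →L[ℝ] E3), IsSkew A → ¬ (a = 0 ∧ A = 0) → ¬ HasKillingSlackTop ν T a A u

/-- **Residual** (maximal frame): every Type-I Clay blow-up has an almost symmetric top.  DECLARED ≡ row F1
(`symmetricCollapse_iff_rowF1`); no movement on `Row_F1` is claimed. -/
@[conjecture] def SymmetricCollapse : Prop :=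
  ∀ (ν T : ℝ), 0 < ν → 0 < T →
    ∀ (u : ℝ → E3 → E3) (p : ℝ → E3 → ℝ),
    IsMaximalSmoothSolution ν 0 u p T → IsLerayHopfOn T ν 0 (u 0) u →
    HasRapidSpatialDecay (u 0) → IsTypeIBlowup u T → HasAlmostSymmetricTop ν T u

/-- F1kt contains F1ks. -/
theorem rowF1ks_of_rowF1kt (h : Row_F1kt) : Row_F1ks :=
  fun ν T hν hT u p hsol hLH hdec hTI hs => h ν T hν hT u p hsol hLH hdec hTI hs.hasAlmostSymmetricTop

/-- F1ks contains F1sy. -/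
theorem rowF1sy_of_rowF1ks (h : Row_F1ks) : Row_F1sy :=
  fun ν T hν hT u p hsol hLH hdec hTI hs => h ν T hν hT u p hsol hLH hdec hTI hs.hasAlmostSymmetricEnd

/-- **The split**: criterion + residual ⇒ row F1 (by cases on extendability). -/
theorem rowF1_of (hD : Row_F1kt) (hR : SymmetricCollapse) : ScenarioCensus.Row_F1 := by
  unfold ScenarioCensus.Row_F1
  intro ν T hν hT u p hsol hLH hdec hTI
  by_contra hext
  exact hext (hD ν T hν hT u p hsol hLH hdec hTI (hR ν T hν hT u p ⟨hsol, hext⟩ hLH hdec hTI))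

/-- The residual is a consequence of the row (vacuously: under `Row_F1` no maximal solution is Type I). -/
theorem symmetricCollapse_of_rowF1 (h : ScenarioCensus.Row_F1) : SymmetricCollapse :=
  fun ν T hν hT u p hmax hLH hdec hTI => (hmax.2 (h ν T hν hT u p hmax.1 hLH hdec hTI)).elim

/-! ## §2 The singular Type-I zoom package with gradients (LINE 15 verbatim) -/

-- `exists_singularZoom_package`: the line restates the tree's `ColumnarTop.exists_singularZoom_package`; taken BY NAME (gate lint dedup.landed).

/-! ## §3 THE KILL: an element of `𝒦_C` annihilated on the open past by a nonzero Killing generator vanishes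
(the two PROVED leaves of route SymmetryModuliCount, BY NAME) -/

/-- **Killing Liouville theorem in `𝒦_C`** (tree, by name): if `W ∈ 𝒦_C` and a NONZERO Killing generator
`(a, A)` (`A` skew) annihilates every slice, `DW(t)·(a + A y) − A W(t, y) = 0` for all `t < 0`, then `W ≡ 0`.
Cases: `a ∈ range A` — then `A ≠ 0`, `a = A c₀` and `K(y) = A(y − (−c₀))` is the rotation field about the axis
through `−c₀`: `SymmetryModuliCount.AxisymEndLiouville` (PROVED, `AxisymEndLiouville_of`: axisymmetric WITH
swirl, any axis, Type-I ancient mild ⇒ 0); `a ∉ range A` — translation or screw motion of nonzero pitch: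
`SymmetryModuliCount.HelicalEndLiouville` (PROVED, `symmetryModuliCount_helicalEndLiouville_proof`). -/
theorem eq_zero_of_killing_annihilated {C : ℝ} {W : ℝ → E3 → E3} (hW : IsTypeIAncientMild C W)
    {a : E3} {A : E3 →L[ℝ] E3} (hA : IsSkew A) (hne : ¬ (a = 0 ∧ A = 0))
    (hsym : ∀ t < 0, ∀ y : E3, fderiv ℝ (W t) y (a + A y) - A (W t y) = 0) :
    ∀ t < 0, ∀ y, W t y = 0 := by
  by_cases ha : a ∈ Set.range A
  · obtain ⟨c₀, hc₀⟩ := ha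
    have hA0 : A ≠ 0 := by
      rintro rfl
      exact hne ⟨by simpa using hc₀.symm, rfl⟩
    refine AxisymEndLiouville_of C W hW (-c₀) A 0 hA hA0 le_rfl ?_
    intro t ht y
    have e : A (y - -c₀) = a + A y := by rw [sub_neg_eq_add, map_add, hc₀, add_comm]
    rw [e]
    exact hsym t ht y
  · exact symmetryModuliCount_helicalEndLiouville_proof C W hW a A 0 hA ha le_rfl hsym

end Summit.NavierStokesRegularity.NavierStokesRegularity.Theorems.ScenarioCensus.SymmetricTop

end

/-! Build note (typer-1 g9, 12:04Z): no-op append to re-trigger the farm build of this module (it stayed `unbuilt` after acceptance, blocking its importers). -/
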